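import Literature.AlgebraicGeometry.Resolution.MonoidalTransformFrameStep
import Mathlib.RingTheory.Valuation.RankOne
import Mathlib.Algebra.Order.GroupWithZero.Range
import HarnessLib

/-!
# [CoP1] Prop. 8.1: the reduction `E = F` by monoidal transforms along the valuation

Topic: `Literature/AlgebraicGeometry/Resolution`. PROOF side of `CossartPiltant2019ReductionP`
(`ArithmeticalThreefoldsLocal.lean`), input (C4): [CoP1] Prop. 8.1 is the head of the
decomposition layer of Prop. 9.3 (`DecompositionLayerStrictParameters.lean`). Its proof (HAL
hal-00139124, pp. 22–23) starts from a local uniformization `S₂` with regular parameters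
`(y₁, y₂, y₃)` in which `f S₂` and `m_{S₀} S₂` are monomial ideals, with index sets `E ⊇ F` of
the parameters dividing them, and reduces to `E = F`:

> Suppose `F ⊂ E`. Take `i₁ ∈ E ∖ F`, `i₂ ∈ F` … Let `S₂⁽¹⁾` be the monoidal transform at
> `(y_{i₁}, y_{i₂})` of `S₂` along `W`. If `W y_{i₂} ≥ W y_{i₁}` … we have achieved a reduction
> in `♯(E ∖ F)`. If `W y_{i₂} < W y_{i₁}` … we have `E⁽¹⁾ = E`, `F⁽¹⁾ = F`. Since `W` has rank
> one, we have `n W y_{i₂} ≥ W y_{i₁}` for some `n ≥ 1` so that we achieve a reduction in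
> `♯(E ∖ F)` after iterating `n` times. Therefore … it can be assumed that `E = F`.

This file PROVES this reduction in the frame of `MonoidalTransformFrameStep.lean` (models
`S[t] ⊆ O_E` of the reduction `Thm. 1.5 ⇒ Prop. 4.10`, `S` universally catenary local domain of
dimension `d`, `E` algebraic over `S`, `O` dominating with algebraic residue extension, of rank
one in the archimedean form `harch`). The monomials are two elements `f = u ∏ x_c^{α_c}`,
`h = w ∏ x_c^{β_c}` of `E` (`u`, `w` of value `0`), `E = supp α ⊇ F = supp β ≠ ∅`:

* `exists_frameStep_measure_lt` — one step at `(y_{i₁}, y_{i₂})` when `W y_{i₂} ≥ W y_{i₁}`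
  lowers `♯(E ∖ F)`;
* `exists_frameSteps_measure_lt` — "after iterating `n` times" (induction on the archimedean
  bound);
* `exists_frameSteps_supp_eq` — the reduction to `E = F`.

Everything is PROVED; no named facts, definitions, instances or notation are introduced.

## Sources

* V. Cossart, O. Piltant, J. Algebra 320 (2008) 1051–1082: proof of Prop. 8.1 (HAL
  hal-00139124, pp. 22–23). [CossartPiltant2008]
-/

noncomputable section

namespace Literature.AlgebraicGeometry.Resolution

universe u

open IsLocalRing _root_.Polynomial

section EFReduction

variable {S : Type u} [CommRing S] [IsDomain S] [IsLocalRing S] {E : Type u} [Field E]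
  [Algebra S E] [Algebra.IsAlgebraic S E]
  (hSuc : IsUniversallyCatenaryRing S) (hinj : Function.Injective (algebraMap S E))
  (O : ValuationSubring E) (hSO : ∀ s : S, algebraMap S E s ∈ O)
  (hdom : ∀ s ∈ maximalIdeal S, O.valuation (algebraMap S E s) < 1)
  (hres : ∀ y : O, ∃ q : S[X], (∃ i, q.coeff i ∉ maximalIdeal S) ∧
    O.valuation (q.eval₂ (algebraMap S E) y) < 1)
  {d : ℕ} (hSdim : ringKrullDim S = d)

set_option maxHeartbeats 1600000 in
include hSuc hinj hSO hdom hres hSdim in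
/-- **One step of the `E = F` reduction lowers `♯(E ∖ F)`** ([CoP1] HAL p. 23, case
`W y_{i₂} ≥ W y_{i₁}`): for a regular `R_t = locAtCentre S[t] O` with regular parameters `x`,
`f = u ∏ x^{α}`, `h = w ∏ x^{β}` with `supp β ⊆ supp α`, `i₁ ∈ E ∖ F`, `i₂ ∈ F` and
`v(x_{i₂}) ≤ v(x_{i₁})`, the monoidal transform at `(x_{i₁}, x_{i₂})` along `O` is the local
ring of a model `S[t′] ⊇ S[t]`, regular, where `f`, `h` are again units times monomials in a
regular system of parameters with `supp β′ ⊆ supp α′`, `F′ ≠ ∅` and `♯(E′ ∖ F′) < ♯(E ∖ F)`.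
[cite: CossartPiltant2008, proof of Prop. 8.1 (HAL p. 23)] -/
theorem exists_frameStep_measure_lt
    (t : Set E) (ht : t.Finite) (hTO : (Algebra.adjoin S t).toSubring ≤ O.toSubring)
    (hreg : IsRegularLocalRing (locAtCentre (Algebra.adjoin S t).toSubring O))
    (x : Fin d → locAtCentre (Algebra.adjoin S t).toSubring O)
    (hx : haveI := isLocalRing_locAtCentre hTO
      Ideal.span (Set.range x) = maximalIdeal _)
    (f h u w : E) (huR : u ∈ locAtCentre (Algebra.adjoin S t).toSubring O)
    (hvu : O.valuation u = 1) (hwR : w ∈ locAtCentre (Algebra.adjoin S t).toSubring O)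
    (hvw : O.valuation w = 1) (α β : Fin d → ℕ)
    (hf : f = u * ∏ c, (x c : E) ^ α c) (hh : h = w * ∏ c, (x c : E) ^ β c)
    (hFE : ∀ c, 0 < β c → 0 < α c) (i₁ i₂ : Fin d) (hα₁ : 0 < α i₁) (hβ₁ : β i₁ = 0)
    (hβ₂ : 0 < β i₂) (hle : O.valuation (x i₂ : E) ≤ O.valuation (x i₁ : E)) :
    ∃ (t' : Set E), t ⊆ t' ∧ t'.Finite ∧
      ∃ (hT'O : (Algebra.adjoin S t').toSubring ≤ O.toSubring),
        IsRegularLocalRing (locAtCentre (Algebra.adjoin S t').toSubring O) ∧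
        ∃ (x' : Fin d → locAtCentre (Algebra.adjoin S t').toSubring O) (u' w' : E)
          (α' β' : Fin d → ℕ),
          (haveI := isLocalRing_locAtCentre hT'O
           Ideal.span (Set.range x') = maximalIdeal _) ∧
          u' ∈ locAtCentre (Algebra.adjoin S t').toSubring O ∧ O.valuation u' = 1 ∧
          w' ∈ locAtCentre (Algebra.adjoin S t').toSubring O ∧ O.valuation w' = 1 ∧
          f = u' * ∏ c, (x' c : E) ^ α' c ∧ h = w' * ∏ c, (x' c : E) ^ β' c ∧
          (∀ c, 0 < β' c → 0 < α' c) ∧ (∃ c, 0 < β' c) ∧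
          (Finset.univ.filter (fun c => 0 < α' c ∧ β' c = 0)).card <
            (Finset.univ.filter (fun c => 0 < α c ∧ β c = 0)).card := by
  classical
  have h12 : i₁ ≠ i₂ := by rintro rfl; exact (Nat.lt_irrefl 0) (hβ₁ ▸ hβ₂)
  set z : E := (x i₂ : E) / (x i₁ : E) with hzdef
  -- the old measure set contains `i₁`
  have hi₁mem : i₁ ∈ Finset.univ.filter (fun c => 0 < α c ∧ β c = 0) :=
    Finset.mem_filter.mpr ⟨Finset.mem_univ _, hα₁, hβ₁⟩
  have hzle : O.valuation z ≤ 1 := by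
    by_cases h0 : (x i₁ : E) = 0
    · rw [hzdef, h0, div_zero, map_zero]; exact zero_le_one
    · rw [hzdef, map_div₀]; exact div_le_one_of_le₀ hle zero_le
  rcases hzle.lt_or_eq with hlt | h1
  · /- `v(z) > 0`: `z` is a new regular parameter, `i₁` enters `F` -/
    obtain ⟨hT₁O, hreg₁, x', hx'c, hx'b, hspan, hmono⟩ :=
      exists_frameStep_of_valuation_lt_one hSuc hinj O hSO hdom hres hSdim t ht hTO hreg x hx
        i₁ i₂ h12 hlt
    have hsub : locAtCentre (Algebra.adjoin S t).toSubring O ≤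
        locAtCentre (Algebra.adjoin S (insert z t)).toSubring O :=
      locAtCentre_mono O (fun y hy => Algebra.adjoin_mono (Set.subset_insert _ _) hy)
    refine ⟨insert z t, Set.subset_insert _ _, ht.insert z, hT₁O, hreg₁, x', u, w,
      Function.update α i₁ (α i₁ + α i₂), Function.update β i₁ (β i₁ + β i₂), hspan,
      hsub huR, hvu, hsub hwR, hvw, ?_, ?_, fun c hc => ?_, ⟨i₁, ?_⟩, ?_⟩
    · rw [hf, hmono α]
    · rw [hh, hmono β]
    · by_cases hc1 : c = i₁
      · subst hc1
        rw [Function.update_self]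
        exact Nat.add_pos_left hα₁ _
      · rw [Function.update_of_ne hc1] at hc ⊢
        exact hFE c hc
    · rw [Function.update_self, hβ₁, zero_add]; exact hβ₂
    · refine Finset.card_lt_card ⟨fun c hc => ?_, fun hsub' => ?_⟩
      · obtain ⟨-, hαc, hβc⟩ := Finset.mem_filter.mp hc
        have hc1 : c ≠ i₁ := by
          rintro rfl
          rw [Function.update_self, hβ₁, zero_add] at hβc
          exact absurd hβc (Nat.pos_iff_ne_zero.mp hβ₂)
        rw [Function.update_of_ne hc1] at hαc hβc
        exact Finset.mem_filter.mpr ⟨Finset.mem_univ _, hαc, hβc⟩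
      · have hb : Function.update β i₁ (β i₁ + β i₂) i₁ = 0 :=
          (Finset.mem_filter.mp (hsub' hi₁mem)).2.2
        rw [Function.update_self, hβ₁, zero_add] at hb
        exact absurd hb (Nat.pos_iff_ne_zero.mp hβ₂)
  · /- `v(z) = 0`: `z` is a unit, `i₂` leaves `E` and `F`, `i₁` enters `F` -/
    obtain ⟨hT₁O, hreg₁, hunit, x', hx'c, hspan, hmono⟩ :=
      exists_frameStep_of_valuation_eq_one hSuc hinj O hSO hdom hres hSdim t ht hTO hreg x hx
        i₁ i₂ h12 h1
    have hsub : locAtCentre (Algebra.adjoin S t).toSubring O ≤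
        locAtCentre (Algebra.adjoin S (insert z t)).toSubring O :=
      locAtCentre_mono O (fun y hy => Algebra.adjoin_mono (Set.subset_insert _ _) hy)
    have hzR : z ∈ locAtCentre (Algebra.adjoin S (insert z t)).toSubring O :=
      le_locAtCentre _ _ (Algebra.subset_adjoin (Set.mem_insert _ _))
    refine ⟨insert z t, Set.subset_insert _ _, ht.insert z, hT₁O, hreg₁, x',
      u * z ^ α i₂, w * z ^ β i₂,
      Function.update (Function.update α i₁ (α i₁ + α i₂)) i₂ 0,
      Function.update (Function.update β i₁ (β i₁ + β i₂)) i₂ 0, hspan,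
      Subring.mul_mem _ (hsub huR) (Subring.pow_mem _ hzR _), ?_,
      Subring.mul_mem _ (hsub hwR) (Subring.pow_mem _ hzR _), ?_, ?_, ?_,
      fun c hc => ?_, ⟨i₁, ?_⟩, ?_⟩
    · rw [map_mul, map_pow, hvu, h1, one_pow, one_mul]
    · rw [map_mul, map_pow, hvw, h1, one_pow, one_mul]
    · rw [hf, hmono α, mul_assoc]
    · rw [hh, hmono β, mul_assoc]
    · by_cases hc2 : c = i₂
      · subst hc2; rw [Function.update_self] at hc; exact absurd hc (Nat.lt_irrefl 0)
      · rw [Function.update_of_ne hc2] at hc ⊢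
        by_cases hc1 : c = i₁
        · subst hc1
          rw [Function.update_self]
          exact Nat.add_pos_left hα₁ _
        · rw [Function.update_of_ne hc1] at hc ⊢
          exact hFE c hc
    · rw [Function.update_of_ne h12, Function.update_self, hβ₁, zero_add]; exact hβ₂
    · refine Finset.card_lt_card ⟨fun c hc => ?_, fun hsub' => ?_⟩
      · obtain ⟨-, hαc, hβc⟩ := Finset.mem_filter.mp hc
        have hc2 : c ≠ i₂ := by
          rintro rfl
          rw [Function.update_self] at hαc
          exact (Nat.lt_irrefl 0) hαc
        rw [Function.update_of_ne hc2] at hαc hβc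
        have hc1 : c ≠ i₁ := by
          rintro rfl
          rw [Function.update_self, hβ₁, zero_add] at hβc
          exact absurd hβc (Nat.pos_iff_ne_zero.mp hβ₂)
        rw [Function.update_of_ne hc1] at hαc hβc
        exact Finset.mem_filter.mpr ⟨Finset.mem_univ _, hαc, hβc⟩
      · have hb : Function.update (Function.update β i₁ (β i₁ + β i₂)) i₂ 0 i₁ = 0 :=
          (Finset.mem_filter.mp (hsub' hi₁mem)).2.2
        rw [Function.update_of_ne h12, Function.update_self, hβ₁, zero_add] at hb
        exact absurd hb (Nat.pos_iff_ne_zero.mp hβ₂)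

set_option maxHeartbeats 1600000 in
include hSuc hinj hSO hdom hres hSdim in
/-- **"After iterating `n` times"** ([CoP1] HAL p. 23): with `i₁ ∈ E ∖ F`, `i₂ ∈ F` and
`v(x_{i₂})ⁿ ≤ v(x_{i₁})` (rank one), finitely many monoidal transforms at `(x_{i₁}, x_{i₂})`
along `O` — first in the chart `x_{i₁}/x_{i₂}` while `W y_{i₂} < W y_{i₁}`, then once in the
chart `x_{i₂}/x_{i₁}` — lower `♯(E ∖ F)`. [cite: CossartPiltant2008, proof of Prop. 8.1 (HAL p. 23)] -/
theorem exists_frameSteps_measure_lt (n : ℕ) :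
    ∀ (t : Set E) (_ : t.Finite) (hTO : (Algebra.adjoin S t).toSubring ≤ O.toSubring)
      (_ : IsRegularLocalRing (locAtCentre (Algebra.adjoin S t).toSubring O))
      (x : Fin d → locAtCentre (Algebra.adjoin S t).toSubring O)
      (_ : haveI := isLocalRing_locAtCentre hTO
        Ideal.span (Set.range x) = maximalIdeal _)
      (f h u w : E) (_ : u ∈ locAtCentre (Algebra.adjoin S t).toSubring O)
      (_ : O.valuation u = 1) (_ : w ∈ locAtCentre (Algebra.adjoin S t).toSubring O)
      (_ : O.valuation w = 1) (α β : Fin d → ℕ)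
      (_ : f = u * ∏ c, (x c : E) ^ α c) (_ : h = w * ∏ c, (x c : E) ^ β c)
      (_ : ∀ c, 0 < β c → 0 < α c) (i₁ i₂ : Fin d) (_ : 0 < α i₁) (_ : β i₁ = 0)
      (_ : 0 < β i₂) (_ : O.valuation (x i₂ : E) ^ n ≤ O.valuation (x i₁ : E)),
    ∃ (t' : Set E), t ⊆ t' ∧ t'.Finite ∧
      ∃ (hT'O : (Algebra.adjoin S t').toSubring ≤ O.toSubring),
        IsRegularLocalRing (locAtCentre (Algebra.adjoin S t').toSubring O) ∧
        ∃ (x' : Fin d → locAtCentre (Algebra.adjoin S t').toSubring O) (u' w' : E)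
          (α' β' : Fin d → ℕ),
          (haveI := isLocalRing_locAtCentre hT'O
           Ideal.span (Set.range x') = maximalIdeal _) ∧
          u' ∈ locAtCentre (Algebra.adjoin S t').toSubring O ∧ O.valuation u' = 1 ∧
          w' ∈ locAtCentre (Algebra.adjoin S t').toSubring O ∧ O.valuation w' = 1 ∧
          f = u' * ∏ c, (x' c : E) ^ α' c ∧ h = w' * ∏ c, (x' c : E) ^ β' c ∧
          (∀ c, 0 < β' c → 0 < α' c) ∧ (∃ c, 0 < β' c) ∧
          (Finset.univ.filter (fun c => 0 < α' c ∧ β' c = 0)).card <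
            (Finset.univ.filter (fun c => 0 < α c ∧ β c = 0)).card := by
  classical
  induction n with
  | zero =>
    intro t ht hTO hreg x hx f h u w huR hvu hwR hvw α β hf hh hFE i₁ i₂ hα₁ hβ₁ hβ₂ hn
    -- `1 ≤ v(x_{i₁}) < 1`: impossible
    exfalso
    haveI := isLocalRing_locAtCentre hTO
    have hlt : O.valuation (x i₁ : E) < 1 :=
      (mem_maximalIdeal_locAtCentre_iff hTO _).mp (hx ▸ Ideal.subset_span ⟨i₁, rfl⟩)
    rw [pow_zero] at hn
    exact (lt_irrefl _) (lt_of_le_of_lt hn hlt)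
  | succ k ih =>
    intro t ht hTO hreg x hx f h u w huR hvu hwR hvw α β hf hh hFE i₁ i₂ hα₁ hβ₁ hβ₂ hn
    by_cases hle : O.valuation (x i₂ : E) ≤ O.valuation (x i₁ : E)
    · exact exists_frameStep_measure_lt hSuc hinj O hSO hdom hres hSdim t ht hTO hreg x hx f h u
        w huR hvu hwR hvw α β hf hh hFE i₁ i₂ hα₁ hβ₁ hβ₂ hle
    · -- `W y_{i₂} < W y_{i₁}`: transform at `(x_{i₂}, x_{i₁})`, chart `z = x_{i₁}/x_{i₂}`
      have h12 : i₁ ≠ i₂ := by rintro rfl; exact (Nat.lt_irrefl 0) (hβ₁ ▸ hβ₂)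
      have hlt' : O.valuation (x i₁ : E) < O.valuation (x i₂ : E) := lt_of_not_ge hle
      haveI := isLocalRing_locAtCentre hTO
      have hx2m : O.valuation (x i₂ : E) < 1 :=
        (mem_maximalIdeal_locAtCentre_iff hTO _).mp (hx ▸ Ideal.subset_span ⟨i₂, rfl⟩)
      have hx2ne : O.valuation (x i₂ : E) ≠ 0 := by
        intro h0
        rw [h0] at hlt'
        exact not_lt_of_ge zero_le hlt'
      have hzlt : O.valuation ((x i₁ : E) / (x i₂ : E)) < 1 := by
        rw [map_div₀, div_lt_one₀ (zero_lt_iff.mpr hx2ne)]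
        exact hlt'
      set z : E := (x i₁ : E) / (x i₂ : E) with hzdef
      obtain ⟨hT₁O, hreg₁, x', hx'c, hx'b, hspan, hmono⟩ :=
        exists_frameStep_of_valuation_lt_one hSuc hinj O hSO hdom hres hSdim t ht hTO hreg x hx
          i₂ i₁ h12.symm hzlt
      have hsub : locAtCentre (Algebra.adjoin S t).toSubring O ≤
          locAtCentre (Algebra.adjoin S (insert z t)).toSubring O :=
        locAtCentre_mono O (fun y hy => Algebra.adjoin_mono (Set.subset_insert _ _) hy)
      -- the new state has the same `E`, `F`, and a smaller archimedean bound
      have hn' : O.valuation (x' i₂ : E) ^ k ≤ O.valuation (x' i₁ : E) := by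
        rw [hx'c i₂ h12.symm, hx'b, map_div₀, le_div_iff₀ (zero_lt_iff.mpr hx2ne), ← pow_succ]
        exact hn
      obtain ⟨t', htt', ht', hT'O, hreg', x'', u', w', α', β', hspan', hu'R, hvu', hw'R, hvw',
        hf', hh', hFE', hF', hcard⟩ :=
        ih (insert z t) (ht.insert z) hT₁O hreg₁ x' hspan f h u w (hsub huR) hvu (hsub hwR) hvw
          (Function.update α i₂ (α i₂ + α i₁)) (Function.update β i₂ (β i₂ + β i₁))
          (by rw [hf, hmono α]) (by rw [hh, hmono β])
          (fun c hc => by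
            by_cases hc2 : c = i₂
            · subst hc2; rw [Function.update_self]; exact Nat.add_pos_left (hFE _ hβ₂) _
            · rw [Function.update_of_ne hc2] at hc ⊢; exact hFE c hc)
          i₁ i₂ (by rw [Function.update_of_ne h12]; exact hα₁)
          (by rw [Function.update_of_ne h12]; exact hβ₁)
          (by rw [Function.update_self]; exact Nat.add_pos_left hβ₂ _) hn'
      refine ⟨t', (Set.subset_insert _ _).trans htt', ht', hT'O, hreg', x'', u', w', α', β',
        hspan', hu'R, hvu', hw'R, hvw', hf', hh', hFE', hF', lt_of_lt_of_le hcard (le_of_eq ?_)⟩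
      -- the measure set is unchanged by this step
      congr 1
      ext c
      simp only [Finset.mem_filter, Finset.mem_univ, true_and]
      by_cases hc2 : c = i₂
      · subst hc2
        rw [Function.update_self, Function.update_self]
        constructor
        · rintro ⟨-, h0⟩; exact absurd h0 (Nat.ne_of_gt (Nat.add_pos_left hβ₂ _))
        · rintro ⟨-, h0⟩; exact absurd h0 (Nat.ne_of_gt hβ₂)
      · rw [Function.update_of_ne hc2, Function.update_of_ne hc2]

set_option maxHeartbeats 1600000 in
include hSuc hinj hSO hdom hres hSdim in
/-- **[CoP1] Prop. 8.1, the reduction to `E = F`** (HAL p. 23: "Therefore, after possibly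
replacing `S₂` by an iterated monoidal transform along `W`, it can be assumed that `E = F`"),
for a rank-one valuation (archimedean value group, `harch`): starting from a regular
`R_t = locAtCentre S[t] O` with regular parameters `x` in which `f = u ∏ x^{α}` and
`h = w ∏ x^{β}` are monomial with `∅ ≠ supp β ⊆ supp α`, there is a larger model `S[t′]`, its
local ring regular, with regular parameters `x′` in which `f`, `h` are monomial with
`supp α′ = supp β′`. [cite: CossartPiltant2008, proof of Prop. 8.1 (HAL p. 23)] -/
theorem exists_frameSteps_supp_eq
    (harch : ∀ y z : E, z ≠ 0 → O.valuation y < 1 → ∃ n : ℕ, O.valuation y ^ n ≤ O.valuation z)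
    (m : ℕ) :
    ∀ (t : Set E) (_ : t.Finite) (hTO : (Algebra.adjoin S t).toSubring ≤ O.toSubring)
      (_ : IsRegularLocalRing (locAtCentre (Algebra.adjoin S t).toSubring O))
      (x : Fin d → locAtCentre (Algebra.adjoin S t).toSubring O)
      (_ : haveI := isLocalRing_locAtCentre hTO
        Ideal.span (Set.range x) = maximalIdeal _)
      (f h u w : E) (_ : u ∈ locAtCentre (Algebra.adjoin S t).toSubring O)
      (_ : O.valuation u = 1) (_ : w ∈ locAtCentre (Algebra.adjoin S t).toSubring O)
      (_ : O.valuation w = 1) (α β : Fin d → ℕ)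
      (_ : f = u * ∏ c, (x c : E) ^ α c) (_ : h = w * ∏ c, (x c : E) ^ β c)
      (_ : ∀ c, 0 < β c → 0 < α c) (_ : ∃ c, 0 < β c)
      (_ : (Finset.univ.filter (fun c => 0 < α c ∧ β c = 0)).card ≤ m),
    ∃ (t' : Set E), t ⊆ t' ∧ t'.Finite ∧
      ∃ (hT'O : (Algebra.adjoin S t').toSubring ≤ O.toSubring),
        IsRegularLocalRing (locAtCentre (Algebra.adjoin S t').toSubring O) ∧
        ∃ (x' : Fin d → locAtCentre (Algebra.adjoin S t').toSubring O) (u' w' : E)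
          (α' β' : Fin d → ℕ),
          (haveI := isLocalRing_locAtCentre hT'O
           Ideal.span (Set.range x') = maximalIdeal _) ∧
          u' ∈ locAtCentre (Algebra.adjoin S t').toSubring O ∧ O.valuation u' = 1 ∧
          w' ∈ locAtCentre (Algebra.adjoin S t').toSubring O ∧ O.valuation w' = 1 ∧
          f = u' * ∏ c, (x' c : E) ^ α' c ∧ h = w' * ∏ c, (x' c : E) ^ β' c ∧
          (∀ c, 0 < α' c ↔ 0 < β' c) := by
  classical
  induction m with
  | zero =>
    intro t ht hTO hreg x hx f h u w huR hvu hwR hvw α β hf hh hFE hF hm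
    refine ⟨t, le_rfl, ht, hTO, hreg, x, u, w, α, β, hx, huR, hvu, hwR, hvw, hf, hh,
      fun c => ⟨fun hαc => ?_, hFE c⟩⟩
    by_contra hβc
    have : c ∈ Finset.univ.filter (fun c => 0 < α c ∧ β c = 0) :=
      Finset.mem_filter.mpr ⟨Finset.mem_univ _, hαc, Nat.eq_zero_of_not_pos hβc⟩
    rw [Nat.le_zero, Finset.card_eq_zero] at hm
    rw [hm] at this
    exact absurd this (Finset.notMem_empty _)
  | succ k ih =>
    intro t ht hTO hreg x hx f h u w huR hvu hwR hvw α β hf hh hFE hF hm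
    by_cases h0 : (Finset.univ.filter (fun c => 0 < α c ∧ β c = 0)).card = 0
    · exact ih t ht hTO hreg x hx f h u w huR hvu hwR hvw α β hf hh hFE hF (h0.trans_le (Nat.zero_le _))
    · -- pick `i₁ ∈ E ∖ F`, `i₂ ∈ F`, and the archimedean bound
      obtain ⟨i₁, hi₁⟩ := Finset.card_pos.mp (Nat.pos_of_ne_zero h0)
      obtain ⟨-, hα₁, hβ₁⟩ := Finset.mem_filter.mp hi₁
      obtain ⟨i₂, hβ₂⟩ := hF
      haveI := isLocalRing_locAtCentre hTO
      have hx2m : O.valuation (x i₂ : E) < 1 :=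
        (mem_maximalIdeal_locAtCentre_iff hTO _).mp (hx ▸ Ideal.subset_span ⟨i₂, rfl⟩)
      have hx1ne : (x i₁ : E) ≠ 0 := by
        intro hz
        have hreg' := hreg
        have hdimR : ringKrullDim (locAtCentre (Algebra.adjoin S t).toSubring O) = d := by
          haveI : Algebra.FiniteType S (Algebra.adjoin S t) := by
            rw [← ht.coe_toFinset]
            exact (Subalgebra.fg_iff_finiteType _).mp (Subalgebra.fg_adjoin_finset _)
          rw [ringKrullDim_locAtCentre_eq_of_frame hSuc hinj O hSO hdom hres (Algebra.adjoin S t)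
            hTO, hSdim]
        have hd : (maximalIdeal (locAtCentre (Algebra.adjoin S t).toSubring O)).spanFinrank = d := by
          have h := IsRegularLocalRing.spanFinrank_maximalIdeal
            (R := locAtCentre (Algebra.adjoin S t).toSubring O)
          rw [hdimR] at h
          exact_mod_cast h
        have hnot : i₁ ∉ (∅ : Set (Fin d)) := Set.notMem_empty _
        have := not_mem_span_image_of_not_mem hd x hx hnot
        rw [Set.image_empty, Ideal.span_empty] at this
        exact this (by rw [show x i₁ = 0 from Subtype.ext hz]; exact Submodule.zero_mem ⊥)
      obtain ⟨n, hn⟩ := harch (x i₂ : E) (x i₁ : E) hx1ne hx2m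
      obtain ⟨t', htt', ht', hT'O, hreg', x', u', w', α', β', hspan', hu'R, hvu', hw'R, hvw', hf',
        hh', hFE', hF', hcard⟩ :=
        exists_frameSteps_measure_lt hSuc hinj O hSO hdom hres hSdim n t ht hTO hreg x hx f h u w
          huR hvu hwR hvw α β hf hh hFE i₁ i₂ hα₁ hβ₁ hβ₂ hn
      obtain ⟨t'', ht't'', ht'', hT''O, hreg'', x'', u'', w'', α'', β'', hspan'', hu''R, hvu'',
        hw''R, hvw'', hf'', hh'', hiff⟩ :=
        ih t' ht' hT'O hreg' x' hspan' f h u' w' hu'R hvu' hw'R hvw' α' β' hf' hh' hFE' hF'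
          (Nat.le_of_lt_succ (lt_of_lt_of_le hcard hm))
      exact ⟨t'', htt'.trans ht't'', ht'', hT''O, hreg'', x'', u'', w'', α'', β'', hspan'', hu''R,
        hvu'', hw''R, hvw'', hf'', hh'', hiff⟩

omit [IsDomain S] [IsLocalRing S] [Algebra.IsAlgebraic S E] in
/-- **Rank one ⇒ archimedean** in the form used above: if `O.valuation` has rank one, then for
`v(y) < 1` and `z ≠ 0` some power of `v(y)` is `≤ v(z)` ("Since `W` has rank one, we have
`n W y_{i₂} ≥ W y_{i₁}` for some `n ≥ 1`", HAL p. 23). [cite: CossartPiltant2008, proof of Prop. 8.1 (HAL p. 23)] -/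
theorem exists_pow_valuation_le_of_rankOne (hr : Nonempty O.valuation.RankOne)
    (y z : E) (hz : z ≠ 0) (hy : O.valuation y < 1) :
    ∃ n : ℕ, O.valuation y ^ n ≤ O.valuation z := by
  obtain ⟨hR⟩ := hr
  haveI : O.valuation.IsNontrivial := hR.toIsNontrivial
  haveI hM : MulArchimedean
      (MonoidWithZeroHom.ValueGroup₀ (MonoidWithZeroHom.ofClass O.valuation)) :=
    Valuation.nonempty_rankOne_iff_mulArchimedean.mp ⟨hR⟩
  by_cases hy0 : O.valuation y = 0
  · exact ⟨1, by rw [pow_one, hy0]; exact zero_le⟩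
  let f := MonoidWithZeroHom.ofClass O.valuation
  let y' := MonoidWithZeroHom.ValueGroup₀.restrict₀ f y
  let z' := MonoidWithZeroHom.ValueGroup₀.restrict₀ f z
  have hey : MonoidWithZeroHom.ValueGroup₀.embedding y' = O.valuation y :=
    MonoidWithZeroHom.ValueGroup₀.embedding_restrict₀ y
  have hez : MonoidWithZeroHom.ValueGroup₀.embedding z' = O.valuation z :=
    MonoidWithZeroHom.ValueGroup₀.embedding_restrict₀ z
  have hy'0 : y' ≠ 0 := by
    intro h; apply hy0; rw [← hey, h, map_zero]
  have hz'0 : z' ≠ 0 := by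
    intro h
    have : O.valuation z = 0 := by rw [← hez, h, map_zero]
    exact hz ((Valuation.zero_iff _).mp this)
  have hy'1 : y' < 1 := by
    rw [← MonoidWithZeroHom.ValueGroup₀.embedding_strictMono.lt_iff_lt, hey, map_one]; exact hy
  have hinv : 1 < y'⁻¹ := one_lt_inv_iff₀.mpr ⟨zero_lt_iff.mpr hy'0, hy'1⟩
  obtain ⟨n, hn⟩ := MulArchimedean.arch z'⁻¹ hinv
  refine ⟨n, ?_⟩
  have h' : y' ^ n ≤ z' := by
    rw [inv_pow] at hn
    exact (inv_le_inv₀ (zero_lt_iff.mpr hz'0) (zero_lt_iff.mpr (pow_ne_zero n hy'0))).mp hn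
  have := MonoidWithZeroHom.ValueGroup₀.embedding_strictMono.monotone h'
  rwa [map_pow, hey, hez] at this

set_option maxHeartbeats 400000 in
include hSuc hinj hSO hdom hres hSdim in
/-- **The `E = F` reduction for a rank-one valuation** (the frame's hypothesis
`Nonempty O.valuation.RankOne`): `exists_frameSteps_supp_eq` with the archimedean property
supplied by `exists_pow_valuation_le_of_rankOne`. [cite: CossartPiltant2008, proof of Prop. 8.1 (HAL p. 23)] -/
theorem exists_frameSteps_supp_eq_of_rankOne (hr : Nonempty O.valuation.RankOne)
    (t : Set E) (ht : t.Finite) (hTO : (Algebra.adjoin S t).toSubring ≤ O.toSubring)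
    (hreg : IsRegularLocalRing (locAtCentre (Algebra.adjoin S t).toSubring O))
    (x : Fin d → locAtCentre (Algebra.adjoin S t).toSubring O)
    (hx : haveI := isLocalRing_locAtCentre hTO
      Ideal.span (Set.range x) = maximalIdeal _)
    (f h u w : E) (huR : u ∈ locAtCentre (Algebra.adjoin S t).toSubring O)
    (hvu : O.valuation u = 1) (hwR : w ∈ locAtCentre (Algebra.adjoin S t).toSubring O)
    (hvw : O.valuation w = 1) (α β : Fin d → ℕ)
    (hf : f = u * ∏ c, (x c : E) ^ α c) (hh : h = w * ∏ c, (x c : E) ^ β c)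
    (hFE : ∀ c, 0 < β c → 0 < α c) (hF : ∃ c, 0 < β c) :
    ∃ (t' : Set E), t ⊆ t' ∧ t'.Finite ∧
      ∃ (hT'O : (Algebra.adjoin S t').toSubring ≤ O.toSubring),
        IsRegularLocalRing (locAtCentre (Algebra.adjoin S t').toSubring O) ∧
        ∃ (x' : Fin d → locAtCentre (Algebra.adjoin S t').toSubring O) (u' w' : E)
          (α' β' : Fin d → ℕ),
          (haveI := isLocalRing_locAtCentre hT'O
           Ideal.span (Set.range x') = maximalIdeal _) ∧
          u' ∈ locAtCentre (Algebra.adjoin S t').toSubring O ∧ O.valuation u' = 1 ∧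
          w' ∈ locAtCentre (Algebra.adjoin S t').toSubring O ∧ O.valuation w' = 1 ∧
          f = u' * ∏ c, (x' c : E) ^ α' c ∧ h = w' * ∏ c, (x' c : E) ^ β' c ∧
          (∀ c, 0 < α' c ↔ 0 < β' c) :=
  exists_frameSteps_supp_eq hSuc hinj O hSO hdom hres hSdim
    (fun y z hz hy => exists_pow_valuation_le_of_rankOne O hr y z hz hy) _ t ht hTO hreg x hx f h
    u w huR hvu hwR hvw α β hf hh hFE hF le_rfl

end EFReduction

end Literature.AlgebraicGeometry.Resolution

end
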